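/-
Copyright (c) 2026. All rights reserved.
Released under Apache 2.0 license as described in the file LICENSE.
Authors: abc-iut cell, prover seat abc-iut-w6-d031 (gen 5; PROOF-ONLY: hypothesis (P) «a parabolic
element in the uniformising group» of the [AbsTopIII] Prop 4.2 (i) geometric column at a GENUINE
punctured Riemann surface — the deck transformation of an end is parabolic).
-/
import Literature.Analysis.Complex.UpperHalfPlaneTranslationEquivariant
import Literature.AnabelianGeometry.AbsoluteAnabelian.ArchimedeanHolFieldFunctorGeometricPSLUniformisedBase
import HarnessLib

/-!
# The deck transformation of a puncture of a uniformised Riemann surface is parabolic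

S. Mochizuki, *Topics in Absolute Anabelian Geometry III*, proof of Prop. 4.2 (i) (p. 106) works at the
uniformised model `X = ℍ/Λ̄` of a hyperbolic Riemann surface of finite type; the classical input that the
PUNCTURES of `X` are CUSPS of `Λ̄` — H. M. Farkas, I. Kra, *Riemann Surfaces* (1992), IV.5.5–IV.5.6,
IV.6 («a puncture … corresponds to a parabolic element»); A. F. Beardon, *The Geometry of Discrete
Groups* (1983), §9.? is NOT needed — is delivered here for the ABSTRACT Möbius deck group of ANY
holomorphic covering `k : ℍ → X` (membership criterion `q ∈ Λ̄ ↔ k (q • τ) = k τ`, abc-iut-w6-d031's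
`HolRS.exists_pslQuotient_iso_of_cover`), in the binder shape (P) of abc-iut-L4-d1's
`HolRS.finiteIndex_subgroupOf_normalizer_of_cusps`.

An END of `X` is presented unwound on the universal covering `w ↦ e^{2πiw}` of the punctured disc: a
holomorphic map `e : ℍ → X` with `e (τ + 1) = e τ` which converges to NO point of `X` as `Im τ → ∞`
(e.g. `e τ = p + r e^{2πiτ}` at a puncture `p` of a plane domain).

* ★ `HolRS.exists_parabolic_mem_of_end` — for such `k`, `Λ̄` (acting freely) and `e`, there is
  `t ∈ SL(2, ℝ)` with `π(t) ∈ Λ̄` and `t` PARABOLIC.  Proof: lift `e` through `k` to `F̃ : ℍ → ℍ`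
  (Mathlib's lifting criterion, `ℍ` simply connected); the two lifts `F̃ (τ + 1)` and `F̃ τ` differ by a
  deck transformation `q ∈ Λ̄`; by abc-iut-w6-d031's `sq_trace_le_four_of_translationEquivariant`
  (Schwarz–Pick vs. translation length) `q` is not hyperbolic; `q ≠ 1`, since otherwise `F̃` has a limit
  in `ℍ` at the cusp (`exists_limit_of_periodic_of_mapsTo`) and `e = k ∘ F̃` would converge in `X`; and
  `q` is not elliptic because an elliptic Möbius map fixes a point of `ℍ` while `Λ̄` acts freely.

PROOF-ONLY (no definition, no named fact); MODEL side of [AbsTopIII] §4; nothing here bears on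
[IUTchIII] Cor. 3.12.

## References

* S. Mochizuki, *Topics in Absolute Anabelian Geometry III* (2015), proof of Prop. 4.2 (i) p.106.
  [MochizukiAbsTopIII2015]
* H. M. Farkas, I. Kra, *Riemann Surfaces*, 2nd ed. (1992), IV.5.5–IV.5.6. [FarkasKra1992]
* A. F. Beardon, *The Geometry of Discrete Groups* (1983), §7.2, Thm. 7.35.1. [Beardon1983]
-/

set_option autoImplicit false

noncomputable section

open Complex Filter Topology Metric Set Function
open scoped UpperHalfPlane MatrixGroups Manifold ContDiff
open UpperHalfPlane (upperHalfPlaneSet isOpen_upperHalfPlaneSet)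
open Literature.Analysis.Complex.TranslationEquivariant

namespace Literature.AnabelianGeometry.AbsoluteAnabelian

namespace HolRS

/-! ### §1 An elliptic real Möbius map fixes a point of `ℍ` -/

/-- An elliptic element of `SL(2, ℝ)` (`(a + d)² < 4`) has a fixed point in `ℍ`: the root
`((a - d) + i √(4 - (a+d)²) · sgn c)/(2c)` of `c z² + (d - a) z - b`. [cite: Beardon1983, Section 7.2] -/
theorem exists_smul_eq_self_of_sq_trace_lt_four (t : SL(2, ℝ))
    (ht : (t 0 0 + t 1 1) ^ 2 < 4) : ∃ τ : ℍ, t • τ = τ := by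
  set a : ℝ := t 0 0 with ha
  set b : ℝ := t 0 1 with hb
  set c : ℝ := t 1 0 with hc
  set d : ℝ := t 1 1 with hd
  have had : a * d - b * c = 1 := by
    have := t.det_coe
    rw [Matrix.det_fin_two] at this
    rw [ha, hb, hc, hd]; linarith
  -- `c ≠ 0`: for `c = 0`, `ad = 1` forces `(a + d)² ≥ 4`
  have hc0 : c ≠ 0 := by
    intro h0
    rw [h0, mul_zero, sub_zero] at had
    nlinarith [sq_nonneg (a - d)]
  set D : ℝ := 4 - (a + d) ^ 2 with hD
  have hD0 : 0 < D := by rw [hD]; linarith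
  set u : ℝ := (a - d) / (2 * c) with hu
  set v : ℝ := Real.sqrt D / (2 * |c|) with hv
  have hv0 : 0 < v := div_pos (Real.sqrt_pos.mpr hD0) (by positivity)
  have hv2 : v ^ 2 * (4 * c ^ 2) = D := by
    have h4 : (2 * |c|) ^ 2 = 4 * c ^ 2 := by rw [mul_pow, sq_abs]; norm_num
    rw [hv, div_pow, h4, div_mul_cancel₀ _ (by positivity : (4 : ℝ) * c ^ 2 ≠ 0),
      Real.sq_sqrt hD0.le]
  set z : ℂ := (u : ℂ) + (v : ℂ) * I with hz
  have hzim : z.im = v := by simp [hz]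
  have hzre : z.re = u := by simp [hz]
  -- `z` is a root of `c z² + (d - a) z - b`
  have hroot : (c : ℂ) * (z * z) + ((d - a : ℝ) : ℂ) * z - b = 0 := by
    apply Complex.ext
    · simp only [Complex.sub_re, Complex.add_re, Complex.mul_re, Complex.mul_im, Complex.ofReal_re,
        Complex.ofReal_im, zero_mul, sub_zero, hzre, hzim, Complex.zero_re]
      have h2cu : 2 * c * u = a - d := by rw [hu]; field_simp
      have hcv : c * (v * v) * (4 * c) = D := by nlinarith [hv2]
      have key : (c * (u * u - v * v) + (d - a) * u - b) * (4 * c) = 0 := by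
        have : (c * (u * u - v * v) + (d - a) * u - b) * (4 * c) =
            (2 * c * u) ^ 2 - c * (v * v) * (4 * c) - 2 * (a - d) * (2 * c * u) - 4 * b * c := by ring
        rw [this, h2cu, hcv, hD]
        nlinarith [had]
      rcases mul_eq_zero.mp key with h | h
      · linarith
      · exfalso; exact hc0 (by linarith)
    · simp only [Complex.sub_im, Complex.add_im, Complex.mul_re, Complex.mul_im, Complex.ofReal_re,
        Complex.ofReal_im, zero_mul, add_zero, sub_zero, hzre, hzim, Complex.zero_im]
      have h2cu : 2 * c * u = a - d := by rw [hu]; field_simp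
      have : c * (u * v + v * u) + (d - a) * v = v * (2 * c * u - (a - d)) := by ring
      rw [this, h2cu, sub_self, mul_zero]
  refine ⟨UpperHalfPlane.mk z (hzim ▸ hv0), ?_⟩
  apply UpperHalfPlane.ext
  rw [UpperHalfPlane.coe_specialLinearGroup_apply]
  simp only [Algebra.algebraMap_self, RingHom.id_apply]
  have hB := denom_ne_zero had (z := z) (hzim ▸ hv0)
  rw [div_eq_iff hB]
  have := moebius_sub_self had (z := z) (hzim ▸ hv0)
  rw [hroot, neg_zero, zero_div, sub_eq_zero, div_eq_iff hB] at this
  exact this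

/-! ### §2 The deck transformation of an end is parabolic -/

/-- ★ **The deck transformation of a puncture is parabolic** — hypothesis (P) of
`HolRS.finiteIndex_subgroupOf_normalizer_of_cusps` for the ABSTRACT Möbius deck group of a genuine
punctured Riemann surface.  Let `k : ℍ → X` be a holomorphic covering of `X ∈ HolRS` with Möbius deck
group `Λ̄ ≤ PSL₂(ℝ)` (membership criterion `k (q • τ) = k τ`) acting freely, and let `e : ℍ → X` be a
holomorphic END: `e (τ + 1) = e τ` and `e τ` converges to no point of `X` as `Im τ → ∞`.  Then `Λ̄`
contains the image of a PARABOLIC `t ∈ SL(2, ℝ)` — the deck transformation of the loop around the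
puncture: it is not hyperbolic by Schwarz–Pick (`sq_trace_le_four_of_translationEquivariant`), not
trivial since otherwise `e` would extend across the puncture (`exists_limit_of_periodic_of_mapsTo`),
and not elliptic since `Λ̄` acts freely. [cite: FarkasKra1992, IV.5.5–IV.5.6]
[cite: MochizukiAbsTopIII2015, Proposition 4.2 (i) proof p.106] -/
theorem exists_parabolic_mem_of_end (X : HolRS) {k : ℍ → X.carrier} (hk : IsCoveringMap k)
    (dk : MDifferentiable 𝓘(ℂ, ℂ) 𝓘(ℂ, ℂ) k) (Λ : Subgroup PSL2R) [IsCancelSMul Λ ℍ]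
    (hΛ : ∀ q : PSL2R, q ∈ Λ ↔ ∀ τ : ℍ, k (q • τ) = k τ)
    {e : ℍ → X.carrier} (de : MDifferentiable 𝓘(ℂ, ℂ) 𝓘(ℂ, ℂ) e)
    (hper : ∀ τ τ' : ℍ, (τ' : ℂ) = τ + 1 → e τ' = e τ)
    (hend : ∀ x : X.carrier, ¬ Tendsto e (comap UpperHalfPlane.im atTop) (𝓝 x)) :
    ∃ t : SL(2, ℝ), (QuotientGroup.mk' (Subgroup.center SL(2, ℝ)) t : PSL2R) ∈ Λ ∧
      (t : Matrix (Fin 2) (Fin 2) ℝ).IsParabolic := by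
  classical
  -- §0 the Möbius deck group is transitive on the fibres of `k` (lifts of `id` are Möbius)
  have htrans : ∀ τ τ' : ℍ, k τ = k τ' → ∃ q ∈ Λ, q • τ = τ' := by
    intro τ τ' h
    have hid : IsCoveringMap (fun x : X.carrier => x) := IsFiniteEtale.id.isCoveringMap
    obtain ⟨γ, hγ, hγτ⟩ :=
      UniformizedLift.exists_sl_lift (π₁ := k) (π₂ := k) (h := fun x : X.carrier => x) hk hk hid dk dk
        mdifferentiable_id (e₁ := τ) (e₂ := τ') h
    refine ⟨(QuotientGroup.mk γ : PSL2R), (hΛ _).2 fun σ => ?_, ?_⟩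
    · rw [psl_mk_smul]; exact hγ σ
    · rw [psl_mk_smul]; exact hγτ
  -- §a the lift `F̃ : ℍ → ℍ` of `e` through `k`
  haveI : Nonempty ℍ := ⟨UpperHalfPlane.I⟩
  have hsurj : Surjective k := hk.surjective_of_connectedSpace'
  obtain ⟨σ₀, hσ₀⟩ := hsurj (e UpperHalfPlane.I)
  let e' : C(ℍ, X.carrier) := ⟨e, de.continuous⟩
  obtain ⟨Fc, ⟨-, hFc⟩, -⟩ := hk.existsUnique_continuousMap_lifts e' UpperHalfPlane.I σ₀ hσ₀
  set Ft : ℍ → ℍ := ⇑Fc with hFt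
  have hlift : ∀ τ : ℍ, k (Ft τ) = e τ := fun τ => congrFun hFc τ
  have hFtc : Continuous Ft := Fc.continuous
  have hFtd : MDifferentiable 𝓘(ℂ, ℂ) 𝓘(ℂ, ℂ) Ft :=
    Literature.Geometry.Kaehler.mdifferentiable_of_comp_eq (p := e) (q := k) de
      (isLocalDiffeomorph_of_mdifferentiable_of_isLocalHomeomorph dk hk.isLocalHomeomorph) hFtc
      (funext hlift)
  -- §b the translation `T τ = τ + 1` and the deck element `q ∈ Λ̄` with `F̃ ∘ T = q • F̃`
  let T : ℍ → ℍ := fun τ => UpperHalfPlane.mk ((τ : ℂ) + 1) (by simpa using τ.im_pos)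
  have hTcoe : ∀ τ : ℍ, ((T τ : ℍ) : ℂ) = τ + 1 := fun τ => rfl
  have hTc : Continuous T := by
    rw [UpperHalfPlane.isEmbedding_coe.continuous_iff]
    exact (UpperHalfPlane.continuous_coe.add continuous_const)
  have heT : ∀ τ : ℍ, e (T τ) = e τ := fun τ => hper τ (T τ) (hTcoe τ)
  obtain ⟨q, hqΛ, hq0⟩ : ∃ q ∈ Λ, q • Ft UpperHalfPlane.I = Ft (T UpperHalfPlane.I) :=
    htrans _ _ (by rw [hlift, hlift, heT])
  have hdeck : ∀ τ : ℍ, Ft (T τ) = q • Ft τ := by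
    have h := hk.eq_of_comp_eq (g₁ := fun τ => Ft (T τ)) (g₂ := fun τ => q • Ft τ)
      (hFtc.comp hTc) (hFtc.const_smul q) (funext fun τ => ?_) UpperHalfPlane.I hq0.symm
    · exact fun τ => congrFun h τ
    · show k (Ft (T τ)) = k (q • Ft τ)
      rw [hlift, heT, (hΛ q).mp hqΛ, hlift]
  -- §c a matrix representative `t` of `q` and the coordinate function `F : ℂ → ℂ`
  obtain ⟨t, rfl⟩ := QuotientGroup.mk_surjective q
  set a : ℝ := t 0 0 with ha
  set b : ℝ := t 0 1 with hb
  set c : ℝ := t 1 0 with hc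
  set d : ℝ := t 1 1 with hd
  have had : a * d - b * c = 1 := by
    have := t.det_coe
    rw [Matrix.det_fin_two] at this
    rw [ha, hb, hc, hd]; linarith
  have hsmul : ∀ τ : ℍ, (((QuotientGroup.mk t : PSL2R) • τ : ℍ) : ℂ) =
      ((a : ℂ) * τ + b) / ((c : ℂ) * τ + d) := fun τ => by
    rw [psl_mk_smul, UpperHalfPlane.coe_specialLinearGroup_apply]
    simp only [Algebra.algebraMap_self, RingHom.id_apply, ha, hb, hc, hd]
  let F : ℂ → ℂ := fun w => if h : 0 < w.im then ((Ft (UpperHalfPlane.mk w h) : ℍ) : ℂ) else 0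
  have hFw : ∀ (w : ℂ) (h : 0 < w.im), F w = ((Ft (UpperHalfPlane.mk w h) : ℍ) : ℂ) := fun w h => by
    simp only [F, dif_pos h]
  have hFτ : ∀ τ : ℍ, F τ = ((Ft τ : ℍ) : ℂ) := fun τ => by
    rw [hFw τ τ.im_pos, UpperHalfPlane.mk_coe]
  have hmaps : MapsTo F upperHalfPlaneSet upperHalfPlaneSet := fun w hw => by
    show 0 < (F w).im
    rw [hFw w hw]
    exact (Ft _).im_pos
  have hFdiff : DifferentiableOn ℂ F upperHalfPlaneSet := fun w hw => by
    have hw : 0 < w.im := hw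
    have hG : MDifferentiable 𝓘(ℂ, ℂ) 𝓘(ℂ, ℂ) (fun τ : ℍ => ((Ft τ : ℍ) : ℂ)) :=
      UpperHalfPlane.mdifferentiable_coe.comp hFtd
    have h1 := (UpperHalfPlane.mdifferentiableAt_iff.mp (hG (UpperHalfPlane.mk w hw)))
    rw [UpperHalfPlane.coe_mk] at h1
    have h2 : (fun z => ((Ft (UpperHalfPlane.ofComplex z) : ℍ) : ℂ)) =ᶠ[𝓝 w] F := by
      filter_upwards [isOpen_upperHalfPlaneSet.mem_nhds hw] with z hz
      have hz : 0 < z.im := hz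
      rw [UpperHalfPlane.ofComplex_apply_of_im_pos hz, hFw z hz]
    exact (h1.congr_of_eventuallyEq h2.symm).differentiableWithinAt
  have heq : ∀ w : ℂ, 0 < w.im → F (w + 1) = ((a : ℂ) * F w + b) / ((c : ℂ) * F w + d) := by
    intro w hw
    have hw1 : 0 < (w + 1).im := by simpa using hw
    have hTmk : T (UpperHalfPlane.mk w hw) = UpperHalfPlane.mk (w + 1) hw1 :=
      UpperHalfPlane.ext (by rw [hTcoe, UpperHalfPlane.coe_mk])
    rw [hFw (w + 1) hw1, hFw w hw, ← hTmk, hdeck, hsmul]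
  -- §d not hyperbolic (Schwarz–Pick versus translation length)
  have hle : (a + d) ^ 2 ≤ 4 := sq_trace_le_four_of_translationEquivariant hFdiff hmaps had heq
  -- §e not trivial: otherwise `e` converges in `X` as `Im τ → ∞`
  have hq1 : (QuotientGroup.mk t : PSL2R) ≠ 1 := by
    intro h1
    have hper' : ∀ w : ℂ, 0 < w.im → F (w + 1) = F w := fun w hw => by
      have hw1 : 0 < (w + 1).im := by simpa using hw
      have hTmk : T (UpperHalfPlane.mk w hw) = UpperHalfPlane.mk (w + 1) hw1 :=
        UpperHalfPlane.ext (by rw [hTcoe, UpperHalfPlane.coe_mk])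
      rw [hFw (w + 1) hw1, hFw w hw, ← hTmk, hdeck, h1, one_smul]
    obtain ⟨τs, hτs, hlim⟩ := exists_limit_of_periodic_of_mapsTo hFdiff hmaps hper'
    -- `F̃ → ⟨τ*, _⟩` in `ℍ` along `Im → ∞`
    have hFlim : Tendsto Ft (comap UpperHalfPlane.im atTop) (𝓝 (UpperHalfPlane.mk τs hτs)) := by
      rw [UpperHalfPlane.isEmbedding_coe.tendsto_nhds_iff]
      rw [Metric.tendsto_nhds]
      intro ε hε
      obtain ⟨A, hA⟩ := hlim ε hε
      have hmem : UpperHalfPlane.im ⁻¹' Ioi A ∈ comap UpperHalfPlane.im atTop :=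
        preimage_mem_comap (Ioi_mem_atTop A)
      filter_upwards [hmem] with τ hτ
      rw [Function.comp_apply, UpperHalfPlane.coe_mk, dist_eq_norm, ← hFτ]
      exact hA τ hτ
    have helim : Tendsto e (comap UpperHalfPlane.im atTop) (𝓝 (k (UpperHalfPlane.mk τs hτs))) := by
      have := (hk.continuous.tendsto _).comp hFlim
      refine this.congr fun τ => ?_
      exact hlift τ
    exact hend _ helim
  -- §f not elliptic: an elliptic element fixes a point of `ℍ`, but `Λ̄` acts freely
  have hge : ¬ (a + d) ^ 2 < 4 := by
    intro hlt
    obtain ⟨τ₁, hτ₁⟩ := exists_smul_eq_self_of_sq_trace_lt_four t (by rw [← ha, ← hd]; exact hlt)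
    have hfix : (⟨QuotientGroup.mk t, hqΛ⟩ : Λ) • τ₁ = τ₁ := by
      show (QuotientGroup.mk t : PSL2R) • τ₁ = τ₁
      rw [psl_mk_smul, hτ₁]
    have := IsCancelSMul.eq_one_of_smul hfix
    exact hq1 (congrArg Subtype.val this)
  have hsq : (a + d) ^ 2 = 4 := le_antisymm hle (not_lt.mp hge)
  -- §g conclusion: `t` is parabolic (non-scalar with vanishing discriminant)
  refine ⟨t, hqΛ, ?_, ?_⟩
  · rintro ⟨r, hr⟩
    apply hq1
    have hmem : t ∈ Subgroup.center SL(2, ℝ) := by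
      rw [Matrix.SpecialLinearGroup.mem_center_iff]
      refine ⟨r, ?_, hr⟩
      have hdet := t.det_coe
      rw [← hr, Matrix.det_fin_two] at hdet
      simp at hdet
      rw [Fintype.card_fin]
      nlinarith [hdet]
    exact (QuotientGroup.eq_one_iff _).mpr hmem
  · rw [Matrix.discr_fin_two, Matrix.trace_fin_two, t.det_coe, ← ha, ← hd]
    linarith

/-! ### §3 The lift and the deck transformation of a periodic holomorphic map (exported data) -/

/-- **The lift and the deck transformation of a `1`-periodic holomorphic map into a uniformised
surface** (the data behind `exists_parabolic_mem_of_end`, exported for the cusp analysis): for a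
holomorphic covering `k : ℍ → X` with Möbius deck group `Λ̄` (membership criterion) acting freely and a
holomorphic `e : ℍ → X` with `e (τ + 1) = e τ`, there are a holomorphic lift `F̃ : ℍ → ℍ`,
`k ∘ F̃ = e`, and a deck transformation `q ∈ Λ̄` with `F̃ (τ + 1) = q • F̃ τ` (Mathlib's lifting
criterion on the simply connected `ℍ`; the two lifts `F̃ (· + 1)`, `q • F̃` agree).
[cite: FarkasKra1992, IV.5.5–IV.5.6] [cite: MochizukiAbsTopIII2015, Proposition 4.2 (i) proof p.106] -/
theorem exists_lift_deck_of_periodic (X : HolRS) {k : ℍ → X.carrier} (hk : IsCoveringMap k)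
    (dk : MDifferentiable 𝓘(ℂ, ℂ) 𝓘(ℂ, ℂ) k) (Λ : Subgroup PSL2R) [IsCancelSMul Λ ℍ]
    (hΛ : ∀ q : PSL2R, q ∈ Λ ↔ ∀ τ : ℍ, k (q • τ) = k τ)
    {e : ℍ → X.carrier} (de : MDifferentiable 𝓘(ℂ, ℂ) 𝓘(ℂ, ℂ) e)
    (hper : ∀ τ τ' : ℍ, (τ' : ℂ) = τ + 1 → e τ' = e τ) :
    ∃ (Ft : ℍ → ℍ) (q : PSL2R), q ∈ Λ ∧ MDifferentiable 𝓘(ℂ, ℂ) 𝓘(ℂ, ℂ) Ft ∧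
      (∀ τ : ℍ, k (Ft τ) = e τ) ∧ ∀ τ τ' : ℍ, (τ' : ℂ) = τ + 1 → Ft τ' = q • Ft τ := by
  classical
  -- the Möbius deck group is transitive on the fibres of `k`
  have htrans : ∀ τ τ' : ℍ, k τ = k τ' → ∃ q ∈ Λ, q • τ = τ' := by
    intro τ τ' h
    have hid : IsCoveringMap (fun x : X.carrier => x) := IsFiniteEtale.id.isCoveringMap
    obtain ⟨γ, hγ, hγτ⟩ :=
      UniformizedLift.exists_sl_lift (π₁ := k) (π₂ := k) (h := fun x : X.carrier => x) hk hk hid dk dk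
        mdifferentiable_id (e₁ := τ) (e₂ := τ') h
    refine ⟨(QuotientGroup.mk γ : PSL2R), (hΛ _).2 fun σ => ?_, ?_⟩
    · rw [psl_mk_smul]; exact hγ σ
    · rw [psl_mk_smul]; exact hγτ
  -- the lift
  haveI : Nonempty ℍ := ⟨UpperHalfPlane.I⟩
  have hsurj : Surjective k := hk.surjective_of_connectedSpace'
  obtain ⟨σ₀, hσ₀⟩ := hsurj (e UpperHalfPlane.I)
  let e' : C(ℍ, X.carrier) := ⟨e, de.continuous⟩
  obtain ⟨Fc, ⟨-, hFc⟩, -⟩ := hk.existsUnique_continuousMap_lifts e' UpperHalfPlane.I σ₀ hσ₀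
  set Ft : ℍ → ℍ := ⇑Fc with hFt
  have hlift : ∀ τ : ℍ, k (Ft τ) = e τ := fun τ => congrFun hFc τ
  have hFtc : Continuous Ft := Fc.continuous
  have hFtd : MDifferentiable 𝓘(ℂ, ℂ) 𝓘(ℂ, ℂ) Ft :=
    Literature.Geometry.Kaehler.mdifferentiable_of_comp_eq (p := e) (q := k) de
      (isLocalDiffeomorph_of_mdifferentiable_of_isLocalHomeomorph dk hk.isLocalHomeomorph) hFtc
      (funext hlift)
  -- the translation and the deck element
  let T : ℍ → ℍ := fun τ => UpperHalfPlane.mk ((τ : ℂ) + 1) (by simpa using τ.im_pos)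
  have hTcoe : ∀ τ : ℍ, ((T τ : ℍ) : ℂ) = τ + 1 := fun τ => rfl
  have hTc : Continuous T := by
    rw [UpperHalfPlane.isEmbedding_coe.continuous_iff]
    exact (UpperHalfPlane.continuous_coe.add continuous_const)
  have heT : ∀ τ : ℍ, e (T τ) = e τ := fun τ => hper τ (T τ) (hTcoe τ)
  obtain ⟨q, hqΛ, hq0⟩ : ∃ q ∈ Λ, q • Ft UpperHalfPlane.I = Ft (T UpperHalfPlane.I) :=
    htrans _ _ (by rw [hlift, hlift, heT])
  have hdeck : ∀ τ : ℍ, Ft (T τ) = q • Ft τ := by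
    have h := hk.eq_of_comp_eq (g₁ := fun τ => Ft (T τ)) (g₂ := fun τ => q • Ft τ)
      (hFtc.comp hTc) (hFtc.const_smul q) (funext fun τ => ?_) UpperHalfPlane.I hq0.symm
    · exact fun τ => congrFun h τ
    · show k (Ft (T τ)) = k (q • Ft τ)
      rw [hlift, heT, (hΛ q).mp hqΛ, hlift]
  refine ⟨Ft, q, hqΛ, hFtd, hlift, fun τ τ' h => ?_⟩
  have hT : T τ = τ' := UpperHalfPlane.ext (by rw [hTcoe, h])
  rw [← hT, hdeck]

end HolRS

end Literature.AnabelianGeometry.AbsoluteAnabelian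

end
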